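import Mathlib
import HarnessLib
import Summits.HubbardSuperconductivity.HubbardSuperconductivity.Theorems.KLProgrammeKLRegimeCountertermJacksonRemainderCurve
import Summits.HubbardSuperconductivity.HubbardSuperconductivity.Theorems.KLProgrammeKLRegimeSplitSlotsV17F
import Summits.HubbardSuperconductivity.HubbardSuperconductivity.Theorems.KLProgrammeKLRegimeSplitFrameExtFnSymmetric
import Summits.HubbardSuperconductivity.HubbardSuperconductivity.Theorems.KLProgrammeKLRegimeCountertermProfileSymmetry
import Summits.HubbardSuperconductivity.HubbardSuperconductivity.Theorems.KLProgrammeKLRegimeCountertermReadingFn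

/-!
# Route `KLProgramme`, crux K3 — gen-8 ENGINE-FLOW child (stmt-HubbardSuperconductivity-20437 `KLRegimeEngineV17F2`), stub (C)
# `stub_twoLeg_curvature`: the (C1) door AT THE FLOW PIECE — `ν_n(K_n) − (klFlowPiece n)∘k_F^{K′}` is minus the Jackson remainder of
# `klFrameExtFn μ (ν_n(K_n))` along the new curve, and its jets `k ≤ 4` (part 3 of the (C1) door; parts 1–2: `…JacksonRemainderLocal/Curve`)

Seat hubbard-kl-k3c3-p1 (g5).  Under scheme F (`…SplitSlotsV17F`): `klFlowPiece n = jacksonFrame (klFlowDeg n) (klFrameExtFn μ f)` with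
`f := θ ↦ klLocalPart L M β U μ (K_n) n θ` the scale-`n` cumulative reading (BY DEFINITION, `klFlowPiece`/`klFlowPieceJackson`).  For ANY frame
`K′` whose Fermi points lie in the flat tube (so that `klFrameExtFn μ f (k_F^{K′} θ) = f θ`, k3c3-p1's `klFrameExtFn_apply_klFermiPoint` of
`…CountertermReadingFn` under the frame hypotheses; here taken as the hypothesis `hon`) — in c4a-1's decomposition `K′ = K_{n+1}` —

* §0 **`norm_iteratedFDeriv_onM_klFrameExtFn_le_near`**: the door's LOCAL sizes `Ml` for `F = klFrameExtFn μ f` — at a point of the open flat tube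
  inside the open centred cell with `‖y‖ ≥ ρ`, `‖DⁿF(y)‖ ≤ n!·G·((n−1)!/ρ)ⁿ` from `‖Dⁱ(f − mean f)‖ ≤ G` (`i ≤ n`) — no cutoff numerals (locality of
  `iteratedFDeriv` + k3c3-p1's `norm_iteratedFDeriv_comp_polarAngle_le_of_le_norm`);
* §1 `isSymmetricFrame_klFrameExtFn_localPart`, `continuous_klFrameExtFn_of_contDiff`, **`flowPiece_eval_sub_eq_neg_jhigh1`**:
  `θ ↦ (klFlowPiece n).eval (k_F^{K′} θ) − f θ = −[jhigh1 (klFlowDeg n) (klFrameExtFn μ f)] (k_F^{K′} θ)` (J1 on the symmetric frame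
  `klFrameExtFn μ f`: `f` is `2π`-periodic, even and `π/2 − θ`-symmetric by k3c3-p3's `klLocalPart_periodic/_neg/_pi_div_two_sub`);
* §2 **`flowPiece_reading_remainder_jets`**: with the symbol `F := klFrameExtFn μ f` read through `EuclideanSpace` (`onM`, `C⁴` by
  `contDiff_onM_klFrameExtFn` when `f ∈ C⁴`, `μ ∈ klWindowC`), LOCAL sizes `Ml` of `DⁱF` on the `r`-ball about the curve point, GLOBAL sizes `B`
  (e.g. `norm_iteratedFDeriv_onM_klFrameExtFn_le`), the margin `δ` (`2δ ≤ r`, `δ ≤ π`) and HONEST jets `‖γ^{(i)}(θ)‖ ≤ Dⁱ` of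
  `γ := toLp ∘ k_F^{K′}`: the value bound and the four jet bounds of part 2 for `θ ↦ f θ − (klFlowPiece n).eval (k_F^{K′} θ)`
  (first-order Jackson gain `m₁` at orders `≤ 3`, `2·Ml 4·D⁴` at order `4`, far mass `π³/((klFlowDeg n + 1)δ)³`), and its `C⁴` regularity.

Law-agnostic (sizes in, sizes out); the fit against `curveJetBar` tables is the assembler's (c4a-1).  Proofs only; no definitions; nothing about
the model is asserted beyond unfolding `klFlowPiece`; nothing here asserts superconductivity.
-/

noncomputable section

namespace Summit.HubbardSuperconductivity.HubbardSuperconductivity.Theorems.KLRegimeSplit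

set_option linter.dupNamespace false -- summit = problem name (single-conjunct summit), D-0017

open Real MeasureTheory Filter
open Literature.Analysis.Fourier.TrigApprox Literature.MathematicalPhysics.QuantumLattice
open Summit.HubbardSuperconductivity.HubbardSuperconductivity.Theorems.PerturbedFermiCurve

/-! ## §0 LOCAL sizes of the G-extension near a flat-tube point: the derivatives there are those of the angular factor -/

section Near

/-- Adding a constant does not change derivatives of positive order. -/
theorem iteratedFDeriv_const_add_of_one_le {E F : Type*} [NormedAddCommGroup E] [NormedSpace ℝ E] [NormedAddCommGroup F] [NormedSpace ℝ F]
    (c : F) (h : E → F) {n : ℕ} (hn : 1 ≤ n) : iteratedFDeriv ℝ n (fun q => c + h q) = iteratedFDeriv ℝ n h := by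
  obtain ⟨k, rfl⟩ : ∃ k, n = k + 1 := ⟨n - 1, by omega⟩
  funext x
  rw [iteratedFDeriv_succ_eq_comp_right, iteratedFDeriv_succ_eq_comp_right]
  simp only [Function.comp_apply]
  congr 2
  funext y
  exact fderiv_const_add c

/-- **Near a point of the open flat tube inside the open centred cell, the G-extension is `mean f + (f − mean f)∘polarAngle`.** -/
theorem onM_klFrameExtFn_eventuallyEq_near (μ : ℝ) (f : ℝ → ℝ) {y : Momentum}
    (htube : |sqDispersion (WithLp.ofLp y) - μ| < klFlatR) (hcell : ∀ i, |WithLp.ofLp y i| < π) :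
    onM (klFrameExtFn μ f) =ᶠ[nhds y]
      fun q : Momentum => klAngularMean f + (f (polarAngle (WithLp.ofLp q)) - klAngularMean f) := by
  have hopen₁ : IsOpen {q : Momentum | |sqDispersion (WithLp.ofLp q) - μ| < klFlatR} :=
    isOpen_lt (continuous_abs.comp (contDiff_sqDispersion_ofLp (N := 0).continuous.sub continuous_const)) continuous_const
  have hopen₂ : IsOpen {q : Momentum | ∀ i, |WithLp.ofLp q i| < π} := by
    rw [show {q : Momentum | ∀ i, |WithLp.ofLp q i| < π} = ⋂ i, {q : Momentum | |WithLp.ofLp q i| < π} by ext q; simp]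
    exact isOpen_iInter_of_finite fun i =>
      isOpen_lt (continuous_abs.comp ((continuous_apply i).comp (PiLp.continuous_ofLp 2 _))) continuous_const
  have hmem : y ∈ {q : Momentum | |sqDispersion (WithLp.ofLp q) - μ| < klFlatR} ∩ {q : Momentum | ∀ i, |WithLp.ofLp q i| < π} :=
    ⟨htube, hcell⟩
  filter_upwards [(hopen₁.inter hopen₂).mem_nhds hmem] with q hq
  obtain ⟨hq₁, hq₂⟩ := hq
  simp only [Set.mem_setOf_eq] at hq₁ hq₂
  show klFrameExtFn μ f (WithLp.ofLp q) = _
  rw [klFrameExtFn_apply_of_flat f (by rw [freeBandFn_eq_sqDispersion]; exact hq₁.le), centredRep_eq_self_of_abs_lt hq₂]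
  ring

/-- **LOCAL SIZES OF THE G-EXTENSION NEAR THE CURVE**: at a point `y` of the open flat tube inside the open centred cell with `‖y‖ ≥ ρ > 0`, for `f`
`Cᴺ` and `2π`-periodic with `‖Dⁱ(f − mean f)‖ ≤ G` (`i ≤ n`), every derivative of order `1 ≤ n ≤ N` of `onM (klFrameExtFn μ f)` at `y` is bounded by
`n!·G·((n−1)!/ρ)ⁿ` (k3c3-p1's `norm_iteratedFDeriv_comp_polarAngle_le_of_le_norm`) — NO cutoff numerals: these are the `Ml` of the (C1) door. -/
theorem norm_iteratedFDeriv_onM_klFrameExtFn_le_near {f : ℝ → ℝ} {N : WithTop ℕ∞} (hf : ContDiff ℝ N f)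
    (hper : Function.Periodic f (2 * Real.pi)) {μ : ℝ} {y : Momentum}
    (htube : |sqDispersion (WithLp.ofLp y) - μ| < klFlatR) (hcell : ∀ i, |WithLp.ofLp y i| < π)
    {ρ : ℝ} (hρ : 0 < ρ) (hρy : ρ ≤ ‖y‖) {n : ℕ} (hn1 : 1 ≤ n) (hn : (n : WithTop ℕ∞) ≤ N) {G : ℝ}
    (hG : ∀ i ≤ n, ∀ t : ℝ, ‖iteratedFDeriv ℝ i (fun t => f t - klAngularMean f) t‖ ≤ G) :
    ‖iteratedFDeriv ℝ n (onM (klFrameExtFn μ f)) y‖ ≤ n.factorial * G * (((n - 1).factorial : ℝ) / ρ) ^ n := by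
  have hloc := onM_klFrameExtFn_eventuallyEq_near μ f htube hcell
  rw [(hloc.iteratedFDeriv ℝ n).eq_of_nhds, iteratedFDeriv_const_add_of_one_le _ _ hn1]
  have hg : ContDiff ℝ N (fun t : ℝ => f t - klAngularMean f) := hf.sub contDiff_const
  have hgper : Function.Periodic (fun t : ℝ => f t - klAngularMean f) (2 * Real.pi) := fun t => by
    show f (t + 2 * Real.pi) - klAngularMean f = f t - klAngularMean f
    rw [hper t]
  exact norm_iteratedFDeriv_comp_polarAngle_le_of_le_norm hg hgper hρ hρy hn hG

end Near

/-! ## §1 The (C1) object is minus the Jackson remainder of the G-extension of the reading -/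

section Object

variable {L M : ℕ} [NeZero L] [NeZero M]

/-- **The G-extension of a cumulative reading is a symmetric frame** (`μ ≥ −39/10`, in particular on `klWindowC`). -/
theorem isSymmetricFrame_klFrameExtFn_localPart (β U : ℝ) {μ : ℝ} (hμ : -(39 / 10) ≤ μ) (K : TrigPolyC4v) (n : ℕ) :
    IsSymmetricFrame (klFrameExtFn μ (klLocalPart L M β U μ K n)) :=
  isSymmetricFrame_klFrameExtFn (klLocalPart_periodic β U μ K n) (fun θ => klLocalPart_neg β U μ K n θ)
    (fun θ => klLocalPart_pi_div_two_sub β U μ K n θ) hμ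

omit [NeZero L] [NeZero M] in
/-- A frame function that is `Cᵐ` through `EuclideanSpace` is continuous. -/
theorem continuous_klFrameExtFn_of_contDiff {μ : ℝ} {f : ℝ → ℝ} {m : ℕ∞} (h : ContDiff ℝ m (onM (klFrameExtFn μ f))) :
    Continuous (klFrameExtFn μ f) :=
  continuous_of_continuous_comp_ofLp h.continuous

/-- **`klFlowPiece n` is the Jackson frame of the G-extension of the scale-`n` cumulative reading** (unfolding). -/
theorem klFlowPiece_eq_jacksonFrame (β U μ : ℝ) (n : ℕ) :
    klFlowPiece L M β U μ n =
      jacksonFrame (klFlowDeg n) (klFrameExtFn μ fun θ => klLocalPart L M β U μ (klFlowFrameU L M β U μ n) n θ) := rfl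

/-- **THE (C1) OBJECT**: for any frame `K′` on whose Fermi points the G-extension reads its profile (`hon`; the flat tube), the difference
`(klFlowPiece n).eval (k_F^{K′} θ) − ν_n(K_n)(θ)` is MINUS the Jackson remainder `jhigh1 (klFlowDeg n) (klFrameExtFn μ ν_n(K_n))` at `k_F^{K′} θ`,
read through `EuclideanSpace` along `γ = toLp ∘ k_F^{K′}`. -/
theorem flowPiece_eval_sub_eq_neg_jhigh1 (β U : ℝ) {μ : ℝ} (hμ : μ ∈ klWindowC) (n : ℕ) (K' : TrigPolyC4v)
    (hf : ContDiff ℝ 4 fun θ : ℝ => klLocalPart L M β U μ (klFlowFrameU L M β U μ n) n θ)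
    (hon : ∀ θ, klFrameExtFn μ (fun θ => klLocalPart L M β U μ (klFlowFrameU L M β U μ n) n θ) (klFermiPoint μ K' θ) =
      klLocalPart L M β U μ (klFlowFrameU L M β U μ n) n θ) :
    (fun θ => (klFlowPiece L M β U μ n).eval (klFermiPoint μ K' θ) - klLocalPart L M β U μ (klFlowFrameU L M β U μ n) n θ) =
      fun θ => -(((fun q : EuclideanSpace ℝ (Fin 2) =>
        jhigh1 (klFlowDeg n) (klFrameExtFn μ fun θ => klLocalPart L M β U μ (klFlowFrameU L M β U μ n) n θ) (WithLp.ofLp q)) ∘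
          fun θ => (WithLp.toLp 2 (klFermiPoint μ K' θ) : EuclideanSpace ℝ (Fin 2))) θ) := by
  have hμ' : -(39 / 10 : ℝ) ≤ μ := by
    simp only [klWindowC, Set.mem_Icc] at hμ; linarith [hμ.1]
  have hsym := isSymmetricFrame_klFrameExtFn_localPart (L := L) (M := M) β U hμ' (klFlowFrameU L M β U μ n) n
  have hper : Function.Periodic (fun θ : ℝ => klLocalPart L M β U μ (klFlowFrameU L M β U μ n) n θ) (2 * Real.pi) :=
    klLocalPart_periodic β U μ _ n
  have hcd : ContDiff ℝ 4 (onM (klFrameExtFn μ fun θ => klLocalPart L M β U μ (klFlowFrameU L M β U μ n) n θ)) :=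
    contDiff_onM_klFrameExtFn (N := 4) hf hper hμ
  have hc := continuous_klFrameExtFn_of_contDiff hcd
  have h := jacksonFrame_curve_sub_eq (klFlowDeg n) hc hsym.1 hsym.2.1 hsym.2.2
    (γ := fun θ => (WithLp.toLp 2 (klFermiPoint μ K' θ) : EuclideanSpace ℝ (Fin 2))) (f := fun θ => klLocalPart L M β U μ (klFlowFrameU L M β U μ n) n θ)
    (fun θ => by simpa using hon θ)
  rw [klFlowPiece_eq_jacksonFrame]
  simpa using h

end Object

/-! ## §2 The jets of the (C1) object from local / global symbol sizes and honest curve jets -/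

section Jets

variable {L M : ℕ} [NeZero L] [NeZero M]

/-- **THE (C1) DOOR AT THE FLOW PIECE.**  Let `f = ν_n(K_n)` (`C⁴`), `F = klFrameExtFn μ f` read through `EuclideanSpace` with GLOBAL sizes
`‖DⁱF‖ ≤ B i` and LOCAL sizes `‖DⁱF(y)‖ ≤ Ml i` for `‖y − γ θ‖ ≤ r` (`i ≤ 4`), `γ = toLp ∘ k_F^{K′}` `C⁴` with `‖γ^{(i)}(θ)‖ ≤ Dⁱ` (`1 ≤ i ≤ 4`),
`0 < δ ≤ π`, `2δ ≤ r`, `d = klFlowDeg n`, `m₁` any first-moment bound `∫J̃_dJ̃_d(|s|+|t|) ≤ m₁`, `τ = π³/((d+1)δ)³`, and the G-extension reads `f` on `K′`'s Fermi points (`hon`).  Then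
`R := θ ↦ (klFlowPiece n).eval (k_F^{K′} θ) − f θ` is `C⁴` and, with `Q₁ = Ml 2·m₁ + (B 1 + Ml 1)τ`, `Q₂ = Ml 3·m₁ + (B 2 + Ml 2)τ`,
`Q₃ = Ml 4·m₁ + (B 3 + Ml 3)τ`, `Q₄ = 2Ml 4 + B 4·τ`: `|R θ| ≤ Ml 1·m₁ + (B 0 + Ml 0)τ`, `|R′| ≤ Q₁D`, `|R″| ≤ (Q₂+Q₁)D²`, `|R‴| ≤ (Q₃+3Q₂+Q₁)D³`,
`|R⁗| ≤ (Q₄+6Q₃+7Q₂+Q₁)D⁴`. -/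
theorem flowPiece_reading_remainder_jets (β U : ℝ) {μ : ℝ} (hμ : μ ∈ klWindowC) (n : ℕ) (K' : TrigPolyC4v)
    (hf : ContDiff ℝ 4 fun θ : ℝ => klLocalPart L M β U μ (klFlowFrameU L M β U μ n) n θ)
    (hon : ∀ θ, klFrameExtFn μ (fun θ => klLocalPart L M β U μ (klFlowFrameU L M β U μ n) n θ) (klFermiPoint μ K' θ) =
      klLocalPart L M β U μ (klFlowFrameU L M β U μ n) n θ)
    {B : ℕ → ℝ} (hB : ∀ i ≤ 4, ∀ y, ‖iteratedFDeriv ℝ i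
      (onM (klFrameExtFn μ fun θ => klLocalPart L M β U μ (klFlowFrameU L M β U μ n) n θ)) y‖ ≤ B i)
    (hγ : ContDiff ℝ 4 fun θ => (WithLp.toLp 2 (klFermiPoint μ K' θ) : EuclideanSpace ℝ (Fin 2)))
    {θ r δ D : ℝ} {Ml : ℕ → ℝ}
    (hMl : ∀ i ≤ 4, ∀ y : EuclideanSpace ℝ (Fin 2), ‖y - WithLp.toLp 2 (klFermiPoint μ K' θ)‖ ≤ r →
      ‖iteratedFDeriv ℝ i (onM (klFrameExtFn μ fun θ => klLocalPart L M β U μ (klFlowFrameU L M β U μ n) n θ)) y‖ ≤ Ml i)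
    (hδ : 0 < δ) (hδπ : δ ≤ π) (hδr : 2 * δ ≤ r) {m₁ : ℝ} (hm₁ : ∫ w, jweight (klFlowDeg n) w * (|w.1| + |w.2|) ∂jmeas ≤ m₁)
    (hD : ∀ i, 1 ≤ i → i ≤ 4 →
      ‖iteratedDeriv i (fun θ => (WithLp.toLp 2 (klFermiPoint μ K' θ) : EuclideanSpace ℝ (Fin 2))) θ‖ ≤ D ^ i) :
    ContDiff ℝ 4 (fun θ => (klFlowPiece L M β U μ n).eval (klFermiPoint μ K' θ) - klLocalPart L M β U μ (klFlowFrameU L M β U μ n) n θ) ∧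
    |(klFlowPiece L M β U μ n).eval (klFermiPoint μ K' θ) - klLocalPart L M β U μ (klFlowFrameU L M β U μ n) n θ| ≤
      Ml 1 * m₁ + (B 0 + Ml 0) * (π ^ 3 / ((klFlowDeg n + 1) * δ) ^ 3) ∧
    |iteratedDeriv 1 (fun θ => (klFlowPiece L M β U μ n).eval (klFermiPoint μ K' θ) -
        klLocalPart L M β U μ (klFlowFrameU L M β U μ n) n θ) θ| ≤
      (Ml 2 * m₁ + (B 1 + Ml 1) * (π ^ 3 / ((klFlowDeg n + 1) * δ) ^ 3)) * D ∧
    |iteratedDeriv 2 (fun θ => (klFlowPiece L M β U μ n).eval (klFermiPoint μ K' θ) -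
        klLocalPart L M β U μ (klFlowFrameU L M β U μ n) n θ) θ| ≤
      ((Ml 3 * m₁ + (B 2 + Ml 2) * (π ^ 3 / ((klFlowDeg n + 1) * δ) ^ 3)) +
        (Ml 2 * m₁ + (B 1 + Ml 1) * (π ^ 3 / ((klFlowDeg n + 1) * δ) ^ 3))) * D ^ 2 ∧
    |iteratedDeriv 3 (fun θ => (klFlowPiece L M β U μ n).eval (klFermiPoint μ K' θ) -
        klLocalPart L M β U μ (klFlowFrameU L M β U μ n) n θ) θ| ≤
      ((Ml 4 * m₁ + (B 3 + Ml 3) * (π ^ 3 / ((klFlowDeg n + 1) * δ) ^ 3)) +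
        3 * (Ml 3 * m₁ + (B 2 + Ml 2) * (π ^ 3 / ((klFlowDeg n + 1) * δ) ^ 3)) +
        (Ml 2 * m₁ + (B 1 + Ml 1) * (π ^ 3 / ((klFlowDeg n + 1) * δ) ^ 3))) * D ^ 3 ∧
    |iteratedDeriv 4 (fun θ => (klFlowPiece L M β U μ n).eval (klFermiPoint μ K' θ) -
        klLocalPart L M β U μ (klFlowFrameU L M β U μ n) n θ) θ| ≤
      ((2 * Ml 4 + B 4 * (π ^ 3 / ((klFlowDeg n + 1) * δ) ^ 3)) +
        6 * (Ml 4 * m₁ + (B 3 + Ml 3) * (π ^ 3 / ((klFlowDeg n + 1) * δ) ^ 3)) +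
        7 * (Ml 3 * m₁ + (B 2 + Ml 2) * (π ^ 3 / ((klFlowDeg n + 1) * δ) ^ 3)) +
        (Ml 2 * m₁ + (B 1 + Ml 1) * (π ^ 3 / ((klFlowDeg n + 1) * δ) ^ 3))) * D ^ 4 := by
  set f : ℝ → ℝ := fun θ => klLocalPart L M β U μ (klFlowFrameU L M β U μ n) n θ with hfdef
  set F : (Fin 2 → ℝ) → ℝ := klFrameExtFn μ f with hFdef
  set γ : ℝ → EuclideanSpace ℝ (Fin 2) := fun θ => WithLp.toLp 2 (klFermiPoint μ K' θ) with hγdef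
  have hper : Function.Periodic f (2 * Real.pi) := klLocalPart_periodic β U μ _ n
  have hG : ContDiff ℝ 4 (fun q : EuclideanSpace ℝ (Fin 2) => F (WithLp.ofLp q)) := contDiff_onM_klFrameExtFn (N := 4) hf hper hμ
  have hFc : Continuous F := continuous_of_continuous_comp_ofLp hG.continuous
  have hB' : ∀ i ≤ 4, ∀ y, ‖iteratedFDeriv ℝ i (fun q : EuclideanSpace ℝ (Fin 2) => F (WithLp.ofLp q)) y‖ ≤ B i := hB
  have hMl' : ∀ i ≤ 4, ∀ y : EuclideanSpace ℝ (Fin 2), ‖y - γ θ‖ ≤ r →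
      ‖iteratedFDeriv ℝ i (fun q : EuclideanSpace ℝ (Fin 2) => F (WithLp.ofLp q)) y‖ ≤ Ml i := hMl
  -- the object is minus the remainder along γ
  have hobj := flowPiece_eval_sub_eq_neg_jhigh1 (L := L) (M := M) β U hμ n K' hf hon
  have hR : (fun θ => (klFlowPiece L M β U μ n).eval (klFermiPoint μ K' θ) - f θ) =
      -((fun q : EuclideanSpace ℝ (Fin 2) => jhigh1 (klFlowDeg n) F (WithLp.ofLp q)) ∘ γ) := by
    rw [hobj]; rfl
  obtain ⟨j1, j2, j3, j4⟩ := jacksonRemainder_curve_jets (klFlowDeg n) hFc hG hB' hγ hMl' hδ hδπ hδr hm₁ hD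
  have hval := abs_jhigh1_curve_le (klFlowDeg n) hFc hG hB' hMl' hδ hδπ hδr hm₁
  have hcd := contDiff_jhigh1_comp_curve (klFlowDeg n) hFc hG hB' hγ
  refine ⟨?_, ?_, ?_, ?_, ?_, ?_⟩
  · rw [hR]; exact hcd.neg
  · have e : (klFlowPiece L M β U μ n).eval (klFermiPoint μ K' θ) - f θ =
        -(((fun q : EuclideanSpace ℝ (Fin 2) => jhigh1 (klFlowDeg n) F (WithLp.ofLp q)) ∘ γ) θ) := congrFun hR θ
    rw [e, abs_neg]
    exact hval
  · rw [hR, iteratedDeriv_neg, abs_neg]; exact j1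
  · rw [hR, iteratedDeriv_neg, abs_neg]; exact j2
  · rw [hR, iteratedDeriv_neg, abs_neg]; exact j3
  · rw [hR, iteratedDeriv_neg, abs_neg]; exact j4

end Jets

end Summit.HubbardSuperconductivity.HubbardSuperconductivity.Theorems.KLRegimeSplit

end
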